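import Summits.CriticalPhenomena.PercolationContinuityZ3.Theorems.PercNearOneGluingNoHeavyLowerTailSahiCddBase
import Literature.Probability.LatticeModels.SahiE3Reflection
import HarnessLib

/-!
# THEOREM (cdd): Kahn's Conjecture 5 / Richards–Sahi `C₃` holds whenever ONE of the three monotone events is a CYLINDER COMPLEMENT

Support file (prover prim-ineq-prove-3 gen 13; `--supports stmt-CriticalPhenomena-4575`; memo
`run/shared/lean/prim/prim-ineq-prove-3/FINDING-G13-CDD-THEOREM.md`).  No definitions, no named facts, no sorries, no `native_decide`.
NEW MATHEMATICS (not in print; the general case of three monotone events is OPEN — [Kahn2022, Conj. 5], [LiebSahi2021, p. 3]).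

**THEOREM (`sahiE3_cylCompl_lower_lower_nonneg`).**  For every product probability measure `prodBernoulli p` on `Set ι` (`ι` finite),
every finite `F ⊆ ι` and ALL decreasing events `W₁, W₂`:  `0 ≤ E₃({F ⊆ ω}ᶜ, W₁, W₂)`.
Equivalently (`sahiE3_orEvent_nonneg`, reflection `ω ↦ ωᶜ, p ↦ 1−p`): `0 ≤ E₃(U_F, A, B)` for the OR event `U_F = {ω ∩ F ≠ ∅}` and all
increasing `A, B`; functional form `cddT_nonneg`: `0 ≤ E₃(1_{U_F}, f, g)` for all increasing nonnegative `f, g`.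
Previously in the tree: one PRINCIPAL up-set + two up-sets (Sahi 2008 Thm 2 / `…offTwo`), three cylinder complements (p250930), two
cylinder complements + one decreasing event (p251502, p253346).  Consequence (paper): on every finite FOREST every cubic row
`E₃(D[u|v], W₁, W₂) ≥ 0` with ONE singleton separation and two arbitrary decreasing events — rows 12, 15 (and 36, 44, 33) of
`…FrontierDecRowsLeFive` on forests, all `n`.

PROOF (parts 1–3 + this file).  `T(f,g) := E₃(1_U,f,g)` (bilinear), `D(h) := E[(2·1_U − E1_U)h]`, and for a finite set `K` of
"antithetic" coordinates `P_K(f,g) := Σ_{x⊆K}[T(f^x,g^{K∖x}) + D(f^x(g^x − g^{K∖x}))]` (`f^x` = `f` with the coordinates of `K` frozen to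
`x`; `P_∅ = T`).  (i) TOWER (`cddP_tower`): pivoting a coordinate `e ∉ F ∪ K` gives `P_K(f,g) = p_e²P_K(f¹,g¹) + q_e²P_K(f⁰,g⁰) +
p_eq_e·P_{K∪e}(f,g)`.  (ii) Hence by induction on the number of coordinates on which `f, g` depend beyond `F ∪ K` (`cddP_nonneg_aux`),
`P_K ≥ 0` follows from the BASE CASE `f, g` depending on `F ∪ K` only, where (iii) `P_K ≥ Main_K ≥ 0` (`cddMain_le_cddP_base`,
`cddMain_nonneg`): an explicit identity `P_K = Main_K + R_K` with `Main_K` = Harris covariances of sections + `z`·(monotone differences)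
and `R_K` = sums of `E[1_U u]E[1_U v] + zE[1_U uv]` over successive differences `u, v ≥ 0` (found by an LP over Harris/monotonicity
certificates, kit j124305/j124307; proved by induction on `K` via (†) `cddP_insert_eq` and `base_step`).  (iv) `K = ∅`: `T ≥ 0`; on
indicators `T = sahiE3 (prodBernoulli p)` (`cddT_ind_ind`, via `Sahi2008.sahiE_three_ind`); reflection by `sahiE3_eq_sahiE3_preimage_compl`.
-/

noncomputable section

namespace Summit.CriticalPhenomena.PercolationContinuityZ3.Theorems

namespace SahiCdd

open Literature.Combinatorics.Sahi2008
open Literature.Probability.Percolation.DecisionTree (ind ind_of_mem ind_of_not_mem ind_nonneg)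
open Literature.Probability.Percolation.BHK2006 (weight weight_nonneg blockFubini harris)
open Literature.Probability.LatticeModels (prodBernoulli sahiE3 sahiE3_def)

variable {ι : Type*} [Fintype ι] [DecidableEq ι]

/-! ### The outer induction on free coordinates, and the theorem -/

/-- **P_K ≥ 0 for increasing nonnegative `f, g` depending on `F ∪ K ∪ H`** (induction on `|H|` by the tower lemma; base `H = ∅` by the
certificate). [this work] -/
theorem cddP_nonneg_aux (p : ι → unitInterval) (F : Finset ι) :
    ∀ (n : ℕ) (K H : Finset ι) (f g : Set ι → ℝ), H.card = n →
      (∀ ω, f ω = f (ω ∩ ((F : Set ι) ∪ (K : Set ι) ∪ (H : Set ι)))) →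
      (∀ ω, g ω = g (ω ∩ ((F : Set ι) ∪ (K : Set ι) ∪ (H : Set ι)))) →
      Monotone f → Monotone g → (∀ ω, 0 ≤ f ω) → (∀ ω, 0 ≤ g ω) → 0 ≤ cddP p F K f g := by
  intro n
  induction n with
  | zero =>
    intro K H f g hH hf hg hfm hgm hf0 hg0
    rw [Finset.card_eq_zero] at hH
    subst hH
    simp only [Finset.coe_empty, Set.union_empty] at hf hg
    exact (cddMain_nonneg p F K hfm hgm hf0 hg0).trans (cddMain_le_cddP_base p F K f g hf hg hfm hgm hf0 hg0)
  | succ n ih =>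
    intro K H f g hH hf hg hfm hgm hf0 hg0
    obtain ⟨e, he⟩ : H.Nonempty := Finset.card_pos.1 (by omega)
    have hH' : (H.erase e).card = n := by rw [Finset.card_erase_of_mem he, hH]; rfl
    by_cases heFK : e ∈ F ∨ e ∈ K
    · -- nothing to peel: `F ∪ K ∪ H = F ∪ K ∪ (H.erase e)`
      have hset : (F : Set ι) ∪ (K : Set ι) ∪ (H : Set ι) = (F : Set ι) ∪ (K : Set ι) ∪ ((H.erase e : Finset ι) : Set ι) := by
        ext i
        simp only [Set.mem_union, Finset.mem_coe, Finset.mem_erase]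
        constructor
        · rintro ((h | h) | h)
          · exact Or.inl (Or.inl h)
          · exact Or.inl (Or.inr h)
          · by_cases hie : i = e
            · subst hie; exact Or.inl heFK
            · exact Or.inr ⟨hie, h⟩
        · rintro ((h | h) | ⟨-, h⟩)
          · exact Or.inl (Or.inl h)
          · exact Or.inl (Or.inr h)
          · exact Or.inr h
      rw [hset] at hf hg
      exact ih K (H.erase e) f g hH' hf hg hfm hgm hf0 hg0
    · simp only [not_or] at heFK
      obtain ⟨heF, heK⟩ := heFK
      rw [cddP_tower p heF heK f g]
      have hS : ((F : Set ι) ∪ (K : Set ι) ∪ (H : Set ι)) \ {e} ⊆ (F : Set ι) ∪ (K : Set ι) ∪ ((H.erase e : Finset ι) : Set ι) := by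
        intro i hi
        simp only [Set.mem_sdiff, Set.mem_union, Finset.mem_coe, Set.mem_singleton_iff] at hi
        simp only [Set.mem_union, Finset.mem_coe, Finset.mem_erase]
        rcases hi with ⟨(h | h) | h, hne⟩
        · exact Or.inl (Or.inl h)
        · exact Or.inl (Or.inr h)
        · exact Or.inr ⟨hne, h⟩
      have hset2 : (F : Set ι) ∪ (K : Set ι) ∪ (H : Set ι) = (F : Set ι) ∪ ((insert e K : Finset ι) : Set ι) ∪ ((H.erase e : Finset ι) : Set ι) := by
        ext i
        simp only [Set.mem_union, Finset.mem_coe, Finset.mem_insert, Finset.mem_erase]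
        constructor
        · rintro ((h | h) | h)
          · exact Or.inl (Or.inl h)
          · exact Or.inl (Or.inr (Or.inr h))
          · by_cases hie : i = e
            · exact Or.inl (Or.inr (Or.inl hie))
            · exact Or.inr ⟨hie, h⟩
        · rintro ((h | h | h) | ⟨-, h⟩)
          · exact Or.inl (Or.inl h)
          · subst h; exact Or.inr he
          · exact Or.inl (Or.inr h)
          · exact Or.inr h
      have a1 := ih K (H.erase e) _ _ hH' (dep_insert hf hS) (dep_insert hg hS)
        (fun _ _ hle => hfm (Set.insert_subset_insert hle)) (fun _ _ hle => hgm (Set.insert_subset_insert hle))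
        (fun ω => hf0 _) (fun ω => hg0 _)
      have a0 := ih K (H.erase e) _ _ hH' (dep_sdiff hf hS) (dep_sdiff hg hS)
        (fun _ _ hle => hfm (Set.sdiff_subset_sdiff_left hle)) (fun _ _ hle => hgm (Set.sdiff_subset_sdiff_left hle))
        (fun ω => hf0 _) (fun ω => hg0 _)
      have a2 := ih (insert e K) (H.erase e) f g hH' (by rw [← hset2]; exact hf) (by rw [← hset2]; exact hg) hfm hgm hf0 hg0
      have hp0 : 0 ≤ (p e : ℝ) := (p e).2.1
      have hq0 : 0 ≤ 1 - (p e : ℝ) := sub_nonneg.2 (p e).2.2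
      have t1 : 0 ≤ (p e : ℝ) ^ 2 * cddP p F K (fun ω => f (insert e ω)) (fun ω => g (insert e ω)) :=
        mul_nonneg (pow_nonneg hp0 2) a1
      have t2 : 0 ≤ (1 - (p e : ℝ)) ^ 2 * cddP p F K (fun ω => f (ω \ {e})) (fun ω => g (ω \ {e})) :=
        mul_nonneg (pow_nonneg hq0 2) a0
      have t3 : 0 ≤ (p e : ℝ) * (1 - p e) * cddP p F (insert e K) f g := mul_nonneg (mul_nonneg hp0 hq0) a2
      linarith

omit [DecidableEq ι] in
/-- **THEOREM (cdd, functional form).**  For every product weight, every `F` and all increasing nonnegative `f, g`: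
`0 ≤ T(f,g) = E₃(1_{U_F}, f, g)`. [this work] -/
theorem cddT_nonneg (p : ι → unitInterval) (F : Finset ι) {f g : Set ι → ℝ}
    (hfm : Monotone f) (hgm : Monotone g) (hf0 : ∀ ω, 0 ≤ f ω) (hg0 : ∀ ω, 0 ≤ g ω) :
    0 ≤ cddT p F f g := by
  classical
  rw [← cddP_empty]
  refine cddP_nonneg_aux p F (Finset.univ : Finset ι).card ∅ Finset.univ f g rfl ?_ ?_ hfm hgm hf0 hg0
  · intro ω; simp
  · intro ω; simp

omit [DecidableEq ι] in
/-- `T` on indicators is the tree's event functional `sahiE3 (prodBernoulli p)`. [this work] -/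
theorem cddT_ind_ind (p : ι → unitInterval) (F : Finset ι) (A B : Set (Set ι)) :
    cddT p F (ind A) (ind B) = sahiE3 (prodBernoulli p) (orEvent F) A B := by
  rw [← sahiE_three_ind, sahiE_three]
  unfold cddT
  ring

omit [DecidableEq ι] in
/-- **THEOREM (Kahn–Sahi `E₃ ≥ 0` for an OR event and two increasing events).**  For every product probability measure
`prodBernoulli p` on `Set ι` (`ι` finite), every finite `F ⊆ ι` and all increasing events `A, B`:
`0 ≤ E₃({ω | ω ∩ F ≠ ∅}, A, B)`. [this work] -/
theorem sahiE3_orEvent_nonneg (p : ι → unitInterval) (F : Finset ι) {A B : Set (Set ι)}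
    (hA : IsUpperSet A) (hB : IsUpperSet B) :
    0 ≤ sahiE3 (prodBernoulli p) (orEvent F) A B := by
  rw [← cddT_ind_ind]
  exact cddT_nonneg p F (monotone_ind_of_isUpperSet hA) (monotone_ind_of_isUpperSet hB)
    (fun ω => ind_nonneg _ _) (fun ω => ind_nonneg _ _)

omit [DecidableEq ι] in
/-- **THEOREM (cdd): Kahn's Conjecture 5 / Richards–Sahi `C₃` whenever ONE of the three decreasing events is a CYLINDER COMPLEMENT.**
For every product probability measure on `Set ι` (`ι` finite), every finite `F` and ALL decreasing events `W₁, W₂`: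
`0 ≤ E₃({F ⊆ ω}ᶜ, W₁, W₂)` (reflection `ω ↦ ωᶜ`, `p ↦ 1 − p` of the OR-event form). [this work] -/
theorem sahiE3_cylCompl_lower_lower_nonneg (p : ι → unitInterval) (F : Finset ι) {W₁ W₂ : Set (Set ι)}
    (hW₁ : IsLowerSet W₁) (hW₂ : IsLowerSet W₂) :
    0 ≤ sahiE3 (prodBernoulli p) {ω : Set ι | (F : Set ι) ⊆ ω}ᶜ W₁ W₂ := by
  rw [Literature.Probability.LatticeModels.sahiE3_eq_sahiE3_preimage_compl p MeasurableSet.of_discrete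
    MeasurableSet.of_discrete MeasurableSet.of_discrete]
  have hset : compl ⁻¹' ({ω : Set ι | (F : Set ι) ⊆ ω}ᶜ) = orEvent F := by
    ext ω
    simp only [Set.mem_preimage, Set.mem_compl_iff, Set.mem_setOf_eq, orEvent, Set.subset_def, Finset.mem_coe,
      not_forall, not_not, exists_prop]
  rw [hset]
  exact sahiE3_orEvent_nonneg _ F (Literature.Probability.LatticeModels.isUpperSet_preimage_compl hW₁)
    (Literature.Probability.LatticeModels.isUpperSet_preimage_compl hW₂)

end SahiCdd

end Summit.CriticalPhenomena.PercolationContinuityZ3.Theorems
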